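import Literature.Probability.Percolation.SubgraphMonotonicity
import Literature.Probability.Percolation.SiteConnectionTools
import Summits.CriticalPhenomena.PercolationContinuityZ3.Theses.PercTorusSliceFilling

/-!
# Route `PercTorusSliceFilling`, item `ThinClusterTransport` — local restriction tools

Generic tools for the transport lemma `E_{T_n}[N_sf] ≤ n³ E_{ℤ³}[1{A_m}/|C^{B(m)}(0)|]`:

* `openGraph_restrictConfig`: for injective `f : W → V`, the open graph of the restricted
  configuration `restrictConfig f ω = {e | e.map f ∈ ω}` is the pull-back `(openGraph ω).comap f`;
* transfer of reachability inside `range f` to reachability of the restricted configuration, and a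
  first-exit lemma: an open path from `f a` leaving `range f` yields a vertex `b`, joined to `a` in the
  restricted configuration, with a `G`-neighbour outside `range f`;
* the cluster-counting identity `#{clusters S with P S} = Σ_x 1{P (C x)}/|C x|` on a finite graph.
-/

namespace Summit.CriticalPhenomena.PercolationContinuityZ3.Theorems

open MeasureTheory Set
open Literature.Probability.Percolation Literature.Probability.LatticeModels

namespace PercTorusSliceFillingThinClusterTransport

variable {V W : Type*}

/-- For injective `f`, the open graph of the restricted configuration `{e | e.map f ∈ ω}` is the
pull-back of the open graph of `ω` along `f`. [folklore] -/
theorem openGraph_restrictConfig {f : W → V} (hf : Function.Injective f) (ω : BondConfig V) :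
    openGraph (restrictConfig f ω) = (openGraph ω).comap f := by
  ext a b
  simp only [openGraph_adj, mem_restrictConfig, Sym2.map_mk, SimpleGraph.comap_adj, hf.ne_iff]

/-- The open graph induced on a vertex set `S` is the open graph of the configuration restricted
along the inclusion `S → V`. [folklore] -/
theorem induce_openGraph_eq_restrictConfig (ω : BondConfig V) (S : Set V) :
    (openGraph ω).induce S = openGraph (restrictConfig (Subtype.val : S → V) ω) := by
  rw [openGraph_restrictConfig Subtype.val_injective]
  rfl

/-- `{x ↔ y in S}` in terms of the configuration restricted to `S`. [folklore] -/
theorem mem_openConnIn_iff_restrictConfig (ω : BondConfig V) (S : Set V) (x y : V) :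
    ω ∈ openConnIn S x y ↔ ∃ (hx : x ∈ S) (hy : y ∈ S),
      (openGraph (restrictConfig (Subtype.val : S → V) ω)).Reachable ⟨x, hx⟩ ⟨y, hy⟩ := by
  simp only [openConnIn, mem_setOf_eq, induce_openGraph_eq_restrictConfig]

/-- Reachability inside a subset of `range f` transfers to reachability of the restricted
configuration (for injective `f`). [folklore] -/
theorem reachable_restrictConfig_of_induce [Nonempty W] {f : W → V} (hf : Function.Injective f)
    (ω : BondConfig V) {S : Set V} (hS : S ⊆ Set.range f) {a b : W} (ha : f a ∈ S) (hb : f b ∈ S)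
    (h : ((openGraph ω).induce S).Reachable ⟨f a, ha⟩ ⟨f b, hb⟩) :
    (openGraph (restrictConfig f ω)).Reachable a b := by
  classical
  let ψ : (openGraph ω).induce S →g openGraph (restrictConfig f ω) :=
    { toFun := fun v => Function.invFun f v.1
      map_rel' := by
        rintro ⟨v, hv⟩ ⟨v', hv'⟩ hadj
        obtain ⟨w, rfl⟩ := hS hv
        obtain ⟨w', rfl⟩ := hS hv'
        simp only [Function.leftInverse_invFun hf w, Function.leftInverse_invFun hf w']
        rw [openGraph_restrictConfig hf, SimpleGraph.comap_adj]
        simpa [SimpleGraph.comap_adj] using hadj }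
  have h' := h.map ψ
  simpa [ψ, Function.leftInverse_invFun hf a, Function.leftInverse_invFun hf b] using h'

/-- **First exit through the local boundary.** For injective `f : W → V` (`W` finite), a lattice
configuration `ω ⊆ E(G)` and an open path from `f a` to a vertex outside `range f`: some `b` is
joined to `a` by an open path of the restricted configuration and `f b` has a `G`-neighbour outside
`range f`. [folklore] -/
theorem exists_exit_restrictConfig [Fintype W] [Nonempty W] [DecidableEq V] {G : SimpleGraph V}
    [G.LocallyFinite] {f : W → V} (hf : Function.Injective f) {ω : BondConfig V}
    (hω : ω ⊆ G.edgeSet) {a : W} {y : V} (hy : y ∉ Set.range f)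
    (h : (openGraph ω).Reachable (f a) y) :
    ∃ b : W, (∃ y' ∉ Set.range f, G.Adj (f b) y') ∧
      (openGraph (restrictConfig f ω)).Reachable a b := by
  classical
  have hle : openGraph ω ≤ G := fun u v huv => hω ((openGraph_adj _ _ _).1 huv).1
  set Λ : Finset V := Finset.univ.image f with hΛ
  have hcoe : (↑Λ : Set V) = Set.range f := by
    rw [hΛ, Finset.coe_image, Finset.coe_univ, Set.image_univ]
  have ha : f a ∈ Λ := Finset.mem_image_of_mem f (Finset.mem_univ a)
  have hyΛ : y ∉ Λ := by rwa [← Finset.mem_coe, hcoe]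
  obtain ⟨w⟩ := h
  obtain ⟨z, hz, haΛ, hzΛ, hr⟩ := exists_innerBoundary_reachable_of_walk hle Λ w ha hyΛ
  rw [mem_innerBoundary_iff] at hz
  obtain ⟨hzmem, y', hy'Λ, hadj⟩ := hz
  have hzr : z ∈ Set.range f := by rwa [← hcoe, Finset.mem_coe]
  obtain ⟨b, rfl⟩ := hzr
  refine ⟨b, ⟨y', by rwa [← hcoe, Finset.mem_coe], hadj⟩, ?_⟩
  refine reachable_restrictConfig_of_induce hf ω (S := (↑Λ : Set V)) hcoe.le haΛ hzΛ hr

/-- The vertices reachable from `a` in the restricted configuration map injectively (by `f`) into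
the open cluster of `f a`; in particular their number is at most `|C(f a)|` when the latter is
finite. [folklore] -/
theorem ncard_reachable_restrictConfig_le {f : W → V} (hf : Function.Injective f)
    (ω : BondConfig V) (a : W) (hfin : (openCluster ω (f a)).Finite) :
    Set.ncard {b : W | (openGraph (restrictConfig f ω)).Reachable a b} ≤
      (openCluster ω (f a)).ncard := by
  rw [← Set.ncard_image_of_injective _ hf]
  refine Set.ncard_le_ncard ?_ hfin
  rintro _ ⟨b, hb, rfl⟩
  exact reachable_map_of_restrictConfig hf ω hb

/-- Two vertices have the same open cluster iff one lies in the cluster of the other. [folklore] -/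
theorem openCluster_eq_iff_mem (ω : BondConfig V) (x x₀ : V) :
    openCluster ω x = openCluster ω x₀ ↔ x ∈ openCluster ω x₀ := by
  constructor
  · intro h
    rw [← h]
    exact mem_openCluster_self ω x
  · intro h
    ext y
    simp only [openCluster, mem_setOf_eq] at h ⊢
    exact ⟨fun hxy => h.trans hxy, fun h0y => h.symm.trans h0y⟩

/-- **Cluster counting by mass transport.** On a finite vertex set, the number of open clusters
`S` satisfying `P` equals `Σ_x 1{P (C x)} / |C x|` (each cluster `S` is counted `|S|` times with
weight `1/|S|`). [folklore] -/
theorem ncard_clusters_eq_sum [Fintype V] (ω : BondConfig V) (P : Set V → Prop)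
    [DecidablePred P] :
    (Set.ncard {S : Set V | (∃ x, S = openCluster ω x) ∧ P S} : ℝ) =
      ∑ x, if P (openCluster ω x) then ((openCluster ω x).ncard : ℝ)⁻¹ else 0 := by
  classical
  set C : V → Set V := openCluster ω with hC
  -- the fibre of `C` over `C x₀` is the cluster `C x₀`
  have hfib : ∀ x₀ : V,
      ((Finset.univ.filter fun x => C x = C x₀).card : ℝ) = ((C x₀).ncard : ℝ) := by
    intro x₀
    rw [Set.ncard_eq_toFinset_card' (C x₀)]
    congr 2
    ext x
    simp only [Finset.mem_filter, Finset.mem_univ, true_and, Set.mem_toFinset, hC]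
    exact openCluster_eq_iff_mem ω x x₀
  have hpos : ∀ x₀ : V, ((C x₀).ncard : ℝ) ≠ 0 := by
    intro x₀
    exact_mod_cast Set.ncard_ne_zero_of_mem (mem_openCluster_self ω x₀)
  -- the set of clusters as a finset
  have hset : {S : Set V | (∃ x, S = C x) ∧ P S} =
      ↑((Finset.univ.image C).filter P) := by
    ext S
    simp only [mem_setOf_eq, Finset.coe_filter, Finset.mem_image, Finset.mem_univ, true_and]
    constructor
    · rintro ⟨⟨x, rfl⟩, hP⟩; exact ⟨⟨x, rfl⟩, hP⟩
    · rintro ⟨⟨x, rfl⟩, hP⟩; exact ⟨⟨x, rfl⟩, hP⟩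
  rw [hset, Set.ncard_coe_finset]
  -- regroup the sum over the fibres of `C`
  have hmaps : ∀ x ∈ (Finset.univ : Finset V), C x ∈ Finset.univ.image C := fun x _ =>
    Finset.mem_image_of_mem C (Finset.mem_univ x)
  rw [← Finset.sum_fiberwise_of_maps_to hmaps]
  have hinner : ∀ S ∈ Finset.univ.image C,
      (∑ x ∈ Finset.univ.filter (fun x => C x = S),
        (if P (C x) then ((C x).ncard : ℝ)⁻¹ else 0)) = if P S then 1 else 0 := by
    intro S hS
    obtain ⟨x₀, -, rfl⟩ := Finset.mem_image.1 hS
    rw [Finset.sum_congr rfl (g := fun _ => if P (C x₀) then ((C x₀).ncard : ℝ)⁻¹ else 0)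
      (fun x hx => by rw [(Finset.mem_filter.1 hx).2]), Finset.sum_const, nsmul_eq_mul, hfib x₀]
    split_ifs
    · exact mul_inv_cancel₀ (hpos x₀)
    · exact mul_zero _
  rw [Finset.sum_congr rfl hinner, Finset.sum_boole]

end PercTorusSliceFillingThinClusterTransport

end Summit.CriticalPhenomena.PercolationContinuityZ3.Theorems
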